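import Literature.MathematicalPhysics.QuantumManyBody.BoseGasCatStates
import Literature.Probability.Distributions.GaussianPiDensity
import Summits.AtomisticToContinuum.BoseEinsteinCondensation.Theorems.BECDyadicChainingBaseCoherentMassFreeUpperBoundAux

/-!
# Route `BECDyadicChaining` — crux `BaseCoherentMass` (stmt-AtomisticToContinuum-13193), stub
`stub_freeUpperBound`: the sharp free Dirichlet upper bound `E₀(0, N, L) ≤ 3π²N/L²`

The registered stub `stub_freeUpperBound` of the line `registered` of the crux
`Summit.AtomisticToContinuum.BoseEinsteinCondensation.Theses.BECDyadicChaining.BaseCoherentMass`: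
for the free gas (`v = 0`) in the Dirichlet box `Λ_L = (0,L)³`, `L > 0`, and every particle number `N`,
`groundStateEnergy 0 N L ≤ 3π²N/L²`.

Proof (product trial states). The one-dimensional cut-off sine profile `f = f_η` of the auxiliary
file (`stub_freeUpperBound_profile`: `f ∈ C¹`, `f = 0` off `(0, L)`, `∫ f'² ≤ (π²/L² + η) ∫ f²`)
gives the one-body mode `u(x) = c ∏ₖ f(xₖ)` on `ℝ³`, normalised by `c² (∫f²)³ = 1`; by Tonelli on
`ℝ³ ≃ ℝ × ℝ × ℝ` its kinetic energy is `∑ₖ c² (∫ f'²)(∫ f²)² ≤ 3(π²/L² + η)`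
(`freeUpperBound_exists_oneBody`). The `N`-body product `u^{⊗N}` (`powFun` of
`BoseGasCatStates`) is an admissible Dirichlet trial state with free energy `N · 𝓔₀[u]`
(`rawEnergy_zero_powFun`), so `E₀(0,N,L) ≤ 3N(π²/L² + η)` for every `η > 0`, whence the claim
(`ENNReal.le_of_forall_pos_le_add`). No new definitions (`ennnorm_real_sq` of
`PeriodicBoseGasJastrow` is reused for `‖(r : ℂ)‖₊² = ofReal r²`). All `[folklore]`.

## References

* [LSSY2005] E. H. Lieb, R. Seiringer, J. P. Solovej, J. Yngvason, *The Mathematics of the Bose Gas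
  and its Condensation* (2005), §1.2 (1.16) and Ch. 2 (box energies).
-/

noncomputable section

namespace Summit.AtomisticToContinuum.BoseEinsteinCondensation.Theorems.BaseCoherentMass

open MeasureTheory
open scoped ENNReal NNReal
open Literature.MathematicalPhysics.QuantumManyBody.BoseGas

/-! ### One-body calculus on `ℝ³` -/

/-- **Tonelli on `ℝ³`** for a product of one-variable functions:
`∫_{ℝ³} ∏ₖ Gₖ(xₖ) dx = ∏ₖ ∫ Gₖ` (through the volume-preserving identification
`EuclideanSpace ℝ (Fin 3) ≃ (Fin 3 → ℝ)`). [folklore] -/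
theorem freeUpperBound_lintegral_prod_three {G : Fin 3 → ℝ → ℝ≥0∞} (hG : ∀ j, Measurable (G j)) :
    ∫⁻ x : Space, ∏ j, G j (x j) = ∏ j, ∫⁻ t, G j t := by
  have h := (EuclideanSpace.volume_preserving_symm_measurableEquiv_toLp (Fin 3)).lintegral_comp_emb
    (MeasurableEquiv.measurableEmbedding _) (fun y : Fin 3 → ℝ => ∏ j, G j (y j))
  refine h.trans ?_
  exact Literature.Probability.Distributions.lintegral_fin_nat_prod_eq_prod (fun _ => volume) G hG

/-- **Partial derivatives of a product of coordinate functions**: for `f ∈ C¹(ℝ)`,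
`∂ₖ ∏ⱼ f(xⱼ) = f'(xₖ) ∏_{j ≠ k} f(xⱼ)`. [folklore] -/
theorem freeUpperBound_fderiv_prod_single {f : ℝ → ℝ} (hf : ContDiff ℝ 1 f) (x : Space) (k : Fin 3) :
    fderiv ℝ (fun x : Space => ∏ j : Fin 3, f (x j)) x (EuclideanSpace.single k 1) =
      deriv f (x k) * ∏ j ∈ Finset.univ.erase k, f (x j) := by
  classical
  set e : Fin 3 → (Space →L[ℝ] ℝ) := fun j => (EuclideanSpace.proj j : Space →L[ℝ] ℝ) with he
  have hfac : ∀ j : Fin 3, HasFDerivAt (fun x : Space => f (x j)) (deriv f (x j) • e j) x := fun j =>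
    ((hf.differentiable one_ne_zero) (x j)).hasDerivAt.comp_hasFDerivAt x (e j).hasFDerivAt
  have hprod := HasFDerivAt.finsetProd (u := Finset.univ) fun j _ => hfac j
  rw [hprod.fderiv]
  have hep : ∀ j : Fin 3, e j (EuclideanSpace.single k (1 : ℝ)) = if j = k then 1 else 0 := by
    intro j
    simp [he]
  simp only [FunLike.coe_sum, Finset.sum_apply, FunLike.coe_smul, Pi.smul_apply, hep, smul_eq_mul,
    mul_ite, mul_one, mul_zero, Finset.sum_ite_eq', Finset.mem_univ, if_true]
  ring

/-- The kinetic energy density of a one-particle wave function `Y ↦ u(Y 0)` is the squared gradient of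
`u` at `Y 0`: `|∇(oneFun u)|²(Y) = ∑ₖ |∂ₖu(Y 0)|²`. [folklore] -/
theorem freeUpperBound_kineticDensity_oneFun {u : Space → ℂ} (hu : Differentiable ℝ u) (Y : Config 1) :
    kineticDensity (oneFun u) Y =
      ∑ k : Fin 3, (‖fderiv ℝ u (Y 0) (EuclideanSpace.single k 1)‖₊ : ℝ≥0∞) ^ 2 := by
  have h := (hu (Y 0)).hasFDerivAt.comp Y
    (ContinuousLinearMap.proj (R := ℝ) (φ := fun _ : Fin 1 => Space) 0).hasFDerivAt
  have hd : fderiv ℝ (oneFun u) Y =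
      (fderiv ℝ u (Y 0)).comp (ContinuousLinearMap.proj (R := ℝ) (φ := fun _ : Fin 1 => Space) 0) :=
    h.fderiv
  unfold kineticDensity
  rw [Fin.sum_univ_one]
  refine Finset.sum_congr rfl fun k _ => ?_
  rw [hd, ContinuousLinearMap.comp_apply, ContinuousLinearMap.proj_apply, Pi.single_eq_same]

/-! ### The one-body trial mode -/

/-- **The one-body trial mode.** For `L > 0` and `η > 0` there is `u : ℝ³ → ℂ` with `Y ↦ u(Y 0)` of
class `C¹`, `u = 0` off the open box `(0,L)³`, `∫ |u|² = 1` and free one-body energy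
`∫ |∇u|² ≤ 3(π²/L² + η)`: `u(x) = c ∏ₖ f(xₖ)` with the cut-off sine profile `f` of
`stub_freeUpperBound_profile` and `c² (∫ f²)³ = 1`; then `∫|u|² = c²(∫f²)³ = 1` and
`∫|∇u|² = 3 c² (∫f'²)(∫f²)² ≤ 3(π²/L² + η)` by Tonelli. [folklore] -/
theorem freeUpperBound_exists_oneBody {L : ℝ} (hL : 0 < L) {η : ℝ} (hη : 0 < η) :
    ∃ u : Space → ℂ, ContDiff ℝ 1 (oneFun u) ∧ (∀ x, x ∉ box L → u x = 0) ∧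
      ∫⁻ Y, (‖oneFun u Y‖₊ : ℝ≥0∞) ^ 2 = 1 ∧
      rawEnergy 0 (oneFun u) ≤ 3 * ENNReal.ofReal (Real.pi ^ 2 / L ^ 2 + η) := by
  obtain ⟨f, hf, hf0, hA0, hAtop, hBle⟩ := stub_freeUpperBound_profile L hL η hη
  generalize hA : ∫⁻ t, ENNReal.ofReal (f t ^ 2) = A at hA0 hAtop hBle
  generalize hB : ∫⁻ t, ENNReal.ofReal (deriv f t ^ 2) = B at hBle
  -- measurability of the one-dimensional factors
  have hmf : Measurable fun t => ENNReal.ofReal (f t ^ 2) :=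
    ENNReal.measurable_ofReal.comp (hf.continuous.pow 2).measurable
  have hmf' : Measurable fun t => ENNReal.ofReal (deriv f t ^ 2) :=
    ENNReal.measurable_ofReal.comp ((hf.continuous_deriv le_rfl).pow 2).measurable
  -- the normalising constant `c`, `c² A³ = 1`
  have ha0 : 0 < A.toReal := ENNReal.toReal_pos hA0 hAtop
  set c : ℝ := Real.sqrt ((A.toReal)⁻¹ ^ 3) with hc
  have hc2 : ENNReal.ofReal (c ^ 2) = A⁻¹ ^ 3 := by
    rw [hc, Real.sq_sqrt (pow_nonneg (inv_nonneg.2 ha0.le) 3), ENNReal.ofReal_pow (inv_nonneg.2 ha0.le),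
      ENNReal.ofReal_inv_of_pos ha0, ENNReal.ofReal_toReal hAtop]
  have hnorm : ENNReal.ofReal (c ^ 2) * A ^ 3 = 1 := by
    rw [hc2, ← mul_pow, ENNReal.inv_mul_cancel hA0 hAtop, one_pow]
  -- the mode `u = c ∏ₖ f(xₖ)`
  set g : Space → ℝ := fun x => ∏ j : Fin 3, f (x j) with hg
  have hfj : ∀ j : Fin 3, ContDiff ℝ 1 (fun x : Space => f (x j)) := fun j =>
    hf.comp (contDiff_piLp_apply 2)
  have hgC : ContDiff ℝ 1 g := contDiff_prod fun j _ => hfj j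
  set u : Space → ℂ := fun x => ((c * g x : ℝ) : ℂ) with hu
  have huC : ContDiff ℝ 1 u := Complex.ofRealCLM.contDiff.comp (contDiff_const.mul hgC)
  have huD : Differentiable ℝ u := huC.differentiable one_ne_zero
  have hu1C : ContDiff ℝ 1 (oneFun u) :=
    huC.comp (ContinuousLinearMap.proj (R := ℝ) (φ := fun _ : Fin 1 => Space) 0).contDiff
  -- its partial derivatives
  have hderiv : ∀ (x : Space) (k : Fin 3), fderiv ℝ u x (EuclideanSpace.single k 1) =
      ((c * (deriv f (x k) * ∏ j ∈ Finset.univ.erase k, f (x j)) : ℝ) : ℂ) := by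
    intro x k
    have h1 : HasFDerivAt (fun x => c * g x) (c • fderiv ℝ g x) x :=
      ((hgC.differentiable one_ne_zero) x).hasFDerivAt.const_mul c
    have h2 := Complex.ofRealCLM.hasFDerivAt.comp x h1
    have h3 : fderiv ℝ u x = Complex.ofRealCLM.comp (c • fderiv ℝ g x) := h2.fderiv
    have h4 : fderiv ℝ g x (EuclideanSpace.single k 1) = deriv f (x k) * ∏ j ∈ Finset.univ.erase k, f (x j) :=
      freeUpperBound_fderiv_prod_single hf x k
    rw [h3, ContinuousLinearMap.comp_apply, smul_apply, smul_eq_mul,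
      Complex.ofRealCLM_apply, h4]
  -- the one-variable factors of `|∂ₖu|²`
  set G : Fin 3 → Fin 3 → ℝ → ℝ≥0∞ := fun k j =>
    if j = k then (fun t => ENNReal.ofReal (deriv f t ^ 2)) else (fun t => ENNReal.ofReal (f t ^ 2)) with hG
  have hGk : ∀ k, G k k = fun t => ENNReal.ofReal (deriv f t ^ 2) := fun k => by simp [hG]
  have hGne : ∀ k j, j ≠ k → G k j = fun t => ENNReal.ofReal (f t ^ 2) := fun k j h => by simp [hG, h]
  have hGm : ∀ k j, Measurable (G k j) := by
    intro k j
    by_cases h : j = k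
    · rw [h, hGk]; exact hmf'
    · rw [hGne k j h]; exact hmf
  have hGprod : ∀ (x : Space) (k : Fin 3), ∏ j, G k j (x j) =
      ENNReal.ofReal (deriv f (x k) ^ 2) * ∏ j ∈ Finset.univ.erase k, ENNReal.ofReal (f (x j) ^ 2) := by
    intro x k
    rw [← Finset.mul_prod_erase Finset.univ (fun j => G k j (x j)) (Finset.mem_univ k), hGk]
    exact congrArg _ (Finset.prod_congr rfl fun j hj => by rw [hGne k j (Finset.ne_of_mem_erase hj)])
  have hpt : ∀ (x : Space) (k : Fin 3), (‖fderiv ℝ u x (EuclideanSpace.single k 1)‖₊ : ℝ≥0∞) ^ 2 =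
      ENNReal.ofReal (c ^ 2) * ∏ j, G k j (x j) := by
    intro x k
    rw [hderiv x k, ennnorm_real_sq, hGprod, mul_pow, mul_pow, ← Finset.prod_pow,
      ENNReal.ofReal_mul (sq_nonneg _), ENNReal.ofReal_mul (sq_nonneg _),
      ENNReal.ofReal_prod_of_nonneg fun j _ => sq_nonneg _]
  have hint : ∀ k, ∫⁻ x : Space, ∏ j, G k j (x j) = B * A ^ 2 := by
    intro k
    rw [freeUpperBound_lintegral_prod_three (hGm k),
      ← Finset.mul_prod_erase Finset.univ (fun j => ∫⁻ t, G k j t) (Finset.mem_univ k)]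
    have h1 : ∫⁻ t, G k k t = B := by rw [hGk]; exact hB
    have h2 : ∀ j ∈ Finset.univ.erase k, ∫⁻ t, G k j t = A := fun j hj => by
      rw [hGne k j (Finset.ne_of_mem_erase hj)]; exact hA
    rw [h1, Finset.prod_congr rfl h2, Finset.prod_const, Finset.card_erase_of_mem (Finset.mem_univ k),
      Finset.card_univ, Fintype.card_fin]
  refine ⟨u, hu1C, ?_, ?_, ?_⟩
  · -- support in the box
    intro x hx
    have hx' : ¬ ∀ j, x j ∈ Set.Ioo 0 L := hx
    push Not at hx'
    obtain ⟨j, hj⟩ := hx'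
    simp only [hu, hg]
    rw [Finset.prod_eq_zero (Finset.mem_univ j) (hf0 _ hj), mul_zero, Complex.ofReal_zero]
  · -- normalisation
    calc ∫⁻ Y, (‖oneFun u Y‖₊ : ℝ≥0∞) ^ 2 = ∫⁻ x, (‖u x‖₊ : ℝ≥0∞) ^ 2 :=
          lintegral_funUnique_comp (fun x => (‖u x‖₊ : ℝ≥0∞) ^ 2)
      _ = ∫⁻ x : Space, ENNReal.ofReal (c ^ 2) * ∏ j, ENNReal.ofReal (f (x j) ^ 2) := by
          refine lintegral_congr fun x => ?_
          simp only [hu, hg]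
          rw [ennnorm_real_sq, mul_pow, ← Finset.prod_pow, ENNReal.ofReal_mul (sq_nonneg _),
            ENNReal.ofReal_prod_of_nonneg fun j _ => sq_nonneg _]
      _ = ENNReal.ofReal (c ^ 2) * A ^ 3 := by
          rw [lintegral_const_mul' _ _ ENNReal.ofReal_ne_top,
            freeUpperBound_lintegral_prod_three (G := fun _ => fun t => ENNReal.ofReal (f t ^ 2)) fun _ => hmf]
          simp only [hA, Finset.prod_const, Finset.card_univ, Fintype.card_fin]
      _ = 1 := hnorm
  · -- the free one-body energy
    have hms : ∀ k, Measurable fun x : Space => ENNReal.ofReal (c ^ 2) * ∏ j, G k j (x j) := fun k =>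
      (Finset.measurable_prod _ fun j _ =>
        (hGm k j).comp (by fun_prop : Measurable fun x : Space => x j)).const_mul _
    calc rawEnergy 0 (oneFun u) = ∫⁻ Y, kineticDensity (oneFun u) Y := by
          unfold rawEnergy
          simp only [interaction_zeroPotential, zero_mul, add_zero]
      _ = ∫⁻ Y : Config 1, ∑ k : Fin 3, (‖fderiv ℝ u (Y 0) (EuclideanSpace.single k 1)‖₊ : ℝ≥0∞) ^ 2 := by
          simp only [freeUpperBound_kineticDensity_oneFun huD]
      _ = ∫⁻ x : Space, ∑ k : Fin 3, (‖fderiv ℝ u x (EuclideanSpace.single k 1)‖₊ : ℝ≥0∞) ^ 2 :=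
          lintegral_funUnique_comp (fun x => ∑ k : Fin 3,
            (‖fderiv ℝ u x (EuclideanSpace.single k 1)‖₊ : ℝ≥0∞) ^ 2)
      _ = ∫⁻ x : Space, ∑ k : Fin 3, ENNReal.ofReal (c ^ 2) * ∏ j, G k j (x j) := by
          simp only [hpt]
      _ = ∑ k : Fin 3, ENNReal.ofReal (c ^ 2) * ∫⁻ x : Space, ∏ j, G k j (x j) := by
          rw [lintegral_finsetSum _ fun k _ => hms k]
          exact Finset.sum_congr rfl fun k _ => lintegral_const_mul' _ _ ENNReal.ofReal_ne_top
      _ = 3 * (ENNReal.ofReal (c ^ 2) * (B * A ^ 2)) := by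
          simp only [hint, Finset.sum_const, Finset.card_univ, Fintype.card_fin, nsmul_eq_mul, Nat.cast_ofNat]
      _ ≤ 3 * (ENNReal.ofReal (c ^ 2) * (ENNReal.ofReal (Real.pi ^ 2 / L ^ 2 + η) * A * A ^ 2)) :=
          mul_le_mul_right (mul_le_mul_right (mul_le_mul_left hBle _) _) _
      _ = 3 * ENNReal.ofReal (Real.pi ^ 2 / L ^ 2 + η) * (ENNReal.ofReal (c ^ 2) * A ^ 3) := by ring
      _ = 3 * ENNReal.ofReal (Real.pi ^ 2 / L ^ 2 + η) := by rw [hnorm, mul_one]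

/-! ### The registered stub -/

/-- **Stub — the sharp free Dirichlet upper bound.** `E₀(0, N, L) ≤ 3π²N/L²` for the free gas in the
Dirichlet box of side `L > 0` (product trial states `∏ u_η(x_i)` with `u_η ∈ C¹` vanishing off the box
and Rayleigh quotient `↓ 3π²/L²`, e.g. the sine mode cut off smoothly near the faces; then
`le_of_forall_pos_le_add`). [folklore] -/
theorem stub_freeUpperBound : ∀ (L : ℝ), 0 < L → ∀ N : ℕ,
    groundStateEnergy 0 N L ≤ ENNReal.ofReal (3 * Real.pi ^ 2 / L ^ 2 * N) := by
  intro L hL N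
  refine ENNReal.le_of_forall_pos_le_add fun δ hδ _ => ?_
  have hη : 0 < (δ : ℝ) / (3 * (N + 1)) := by
    have : (0 : ℝ) < δ := hδ
    positivity
  obtain ⟨u, hu, hu0, hu1, huE⟩ := freeUpperBound_exists_oneBody hL hη
  obtain ⟨Ψ, hΨ⟩ : ∃ Ψ : TrialState N L, Ψ.ψ = powFun u N :=
    ⟨{ ψ := powFun u N
       contDiff := contDiff_powFun hu N
       eq_zero := fun X hX => by
         have hX' : ¬ ∀ i, X i ∈ box L := hX
         push Not at hX'
         obtain ⟨i, hi⟩ := hX'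
         exact powFun_eq_zero_of_exists u ⟨i, hu0 _ hi⟩
       symm := fun σ X => powFun_comp_perm u σ X
       norm_eq := lintegral_powFun_sq hu hu1 N }, rfl⟩
  have hreal : (N : ℝ) * (3 * (Real.pi ^ 2 / L ^ 2 + δ / (3 * (N + 1)))) ≤
      3 * Real.pi ^ 2 / L ^ 2 * N + δ := by
    have hδ0 : (0 : ℝ) ≤ δ := δ.coe_nonneg
    have hN : (0 : ℝ) ≤ N := N.cast_nonneg
    have h1 : (N : ℝ) * (δ / (N + 1)) ≤ δ := by
      rw [mul_div_assoc', div_le_iff₀ (by positivity)]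
      nlinarith
    have h2 : (N : ℝ) * (3 * (Real.pi ^ 2 / L ^ 2 + δ / (3 * (N + 1)))) =
        3 * Real.pi ^ 2 / L ^ 2 * N + N * (δ / (N + 1)) := by
      field_simp
    rw [h2]
    linarith
  calc groundStateEnergy 0 N L ≤ energy 0 Ψ := groundStateEnergy_le_energy 0 Ψ
    _ = N * rawEnergy 0 (oneFun u) := by
        rw [energy_eq_rawEnergy, hΨ]
        exact rawEnergy_zero_powFun hu hu1 N
    _ ≤ N * (3 * ENNReal.ofReal (Real.pi ^ 2 / L ^ 2 + δ / (3 * (N + 1)))) := mul_le_mul_right huE _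
    _ = ENNReal.ofReal ((N : ℝ) * (3 * (Real.pi ^ 2 / L ^ 2 + δ / (3 * (N + 1))))) := by
        rw [ENNReal.ofReal_mul N.cast_nonneg, ENNReal.ofReal_natCast,
          ENNReal.ofReal_mul (by norm_num : (0 : ℝ) ≤ 3), ENNReal.ofReal_ofNat]
    _ ≤ ENNReal.ofReal (3 * Real.pi ^ 2 / L ^ 2 * N + δ) := ENNReal.ofReal_le_ofReal hreal
    _ = ENNReal.ofReal (3 * Real.pi ^ 2 / L ^ 2 * N) + δ := by
        rw [ENNReal.ofReal_add (by positivity) δ.coe_nonneg, ENNReal.ofReal_coe_nnreal]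

end Summit.AtomisticToContinuum.BoseEinsteinCondensation.Theorems.BaseCoherentMass

end
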